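import Mathlib
import HarnessLib

/-!
# Gauss rules for Fourier coefficients: the positive weights `c_m`, `s_m`, the odd/even folding of
`∫ sin x g`, `∫ cos x g`, and the panel decomposition of `∫₀¹ sin 2πnx f`, `∫₀¹ cos 2πnx f`
(Davis–Rabinowitz 1984, Sect. 2.10.4)

**Source.** P. J. Davis, P. Rabinowitz, *Methods of Numerical Integration* (2nd ed., Academic Press, 1984),
Sect. 2.10.4 "Use of Gauss Rules for Fourier Coefficients", formulas (2.10.4.1)–(2.10.4.5).

**Statement.** Two devices are described there for computing Fourier coefficients by rules of Gauss type.

(1) With the *positive* weight functions `c_m(x) = ½(1 + cos mπx)`, `s_m(x) = ½(1 + sin mπx)` on `[-1, 1]`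
(`fourierCosWeight`, `fourierSinWeight`; `0 ≤ c_m, s_m ≤ 1`, and `c_m(x) = cos²(mπx/2)`),
  `(1/2π) ∫_{-π}^{π} f(x) cos mx dx = ∫_{-1}^{1} f(πx) c_m(x) dx - ½ ∫_{-1}^{1} f(πx) dx`,
  `(1/2π) ∫_{-π}^{π} f(x) sin mx dx = ∫_{-1}^{1} f(πx) s_m(x) dx - ½ ∫_{-1}^{1} f(πx) dx`      (2.10.4.1)
for every `f` interval-integrable on `[-π, π]` and every real `m` (`fourier_cos_coeff_eq_integral_fourierCosWeight`,
`fourier_sin_coeff_eq_integral_fourierSinWeight`), so that Gauss rules for the weights `c_m`, `s_m` apply to the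
first integrals on the right.

(2) Splitting `[0, 1]` into the `n` panels `[j/n, (j+1)/n]` and substituting `u = 2πnx - (2j+1)π ∈ [-π, π]` on
the `j`-th panel,
  `∫₀¹ φ(2πnx) f(x) dx = (1/2πn) Σ_{j<n} ∫_{-π}^{π} φ(u + (2j+1)π) f(u/2πn + (2j+1)/2n) du`
(`integral_comp_panels`), and since `sin (u + (2j+1)π) = -sin u`, `cos (u + (2j+1)π) = -cos u` the sine and
cosine transforms become sums of `n` integrals against the FIXED weights `sin u`, `cos u` on `[-π, π]`
(`integral_sin_transform_panels`, `integral_cos_transform_panels`; this is the decomposition displayed as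
(2.10.4.2) and (2.10.4.4), written with the panel substitution made explicit).  For the odd weight `sin u` the
method of Sect. 2.7.6 gives rules of the antisymmetric form `Σ w_k [g(x_k) - g(-x_k)]` (2.10.4.3), and for the
even weight `cos u` rules of the symmetric form `Σ w_k [g(x_k) + g(-x_k)] + w_{N+1} g(0)` (2.10.4.5); the
identities behind these shapes are the foldings
  `∫_{-a}^{a} sin x g(x) dx = ∫₀^{a} sin x (g(x) - g(-x)) dx`,
  `∫_{-a}^{a} cos x g(x) dx = ∫₀^{a} cos x (g(x) + g(-x)) dx`
(`integral_sin_mul_eq_integral_fold`, `integral_cos_mul_eq_integral_fold`), valid for every `g`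
interval-integrable on `[-a, a]`.

**Used by / context.** Companion to the tree's anchors for Sect. 2.10.1 (integration between the zeros,
`IntegrationBetweenZeros.lean`), Sect. 2.10.2 (Filon's method) and Sect. 2.10.3 (the Euler transformation,
`EulerTransformation.lean`); the Piessens–Branders tables of the rules (2.10.4.5) themselves are not reproduced.

**Proof sketch / formalization notes.** Everything is elementary real analysis over Mathlib's interval integral:
(2.10.4.1) is linearity plus the substitution `x ↦ πx` (`intervalIntegral.integral_comp_mul_left`); the panel
decomposition is `intervalIntegral.sum_integral_adjacent_intervals` plus `intervalIntegral.integral_comp_div_add`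
on each panel; the foldings are additivity over `[-a, 0] ∪ [0, a]` and `intervalIntegral.integral_comp_neg`.
Integrability hypotheses are the minimal ones (interval integrability of `f`, resp. `g`); `m` is any real number.
No `sorry`, no new axioms.
-/

open Real MeasureTheory intervalIntegral Set

noncomputable section

namespace Literature.Analysis.Quadrature

/-! ### The positive weights `c_m`, `s_m` and formula (2.10.4.1) -/

/-- The weight `c_m(x) = ½ (1 + cos mπx)` of Davis–Rabinowitz (2.10.4.1) (there `m = 0, 1, …`; any real `m` is
allowed here). [cite: DavisRabinowitz1984, Sect. 2.10.4 (2.10.4.1)] -/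
def fourierCosWeight (m x : ℝ) : ℝ := (1 + cos (m * π * x)) / 2

/-- The weight `s_m(x) = ½ (1 + sin mπx)` of Davis–Rabinowitz (2.10.4.1).
[cite: DavisRabinowitz1984, Sect. 2.10.4 (2.10.4.1)] -/
def fourierSinWeight (m x : ℝ) : ℝ := (1 + sin (m * π * x)) / 2

/-- `c_m` is a nonnegative ("positive") weight. [cite: DavisRabinowitz1984, Sect. 2.10.4 (2.10.4.1)] -/
theorem fourierCosWeight_nonneg (m x : ℝ) : 0 ≤ fourierCosWeight m x := by
  unfold fourierCosWeight
  linarith [neg_one_le_cos (m * π * x)]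

/-- `c_m ≤ 1`. [cite: DavisRabinowitz1984, Sect. 2.10.4 (2.10.4.1)] -/
theorem fourierCosWeight_le_one (m x : ℝ) : fourierCosWeight m x ≤ 1 := by
  unfold fourierCosWeight
  linarith [cos_le_one (m * π * x)]

/-- `s_m` is a nonnegative ("positive") weight. [cite: DavisRabinowitz1984, Sect. 2.10.4 (2.10.4.1)] -/
theorem fourierSinWeight_nonneg (m x : ℝ) : 0 ≤ fourierSinWeight m x := by
  unfold fourierSinWeight
  linarith [neg_one_le_sin (m * π * x)]

/-- `s_m ≤ 1`. [cite: DavisRabinowitz1984, Sect. 2.10.4 (2.10.4.1)] -/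
theorem fourierSinWeight_le_one (m x : ℝ) : fourierSinWeight m x ≤ 1 := by
  unfold fourierSinWeight
  linarith [sin_le_one (m * π * x)]

/-- Half-angle form `c_m(x) = cos²(mπx/2)`. [cite: DavisRabinowitz1984, Sect. 2.10.4 (2.10.4.1)] -/
theorem fourierCosWeight_eq_cos_sq (m x : ℝ) : fourierCosWeight m x = cos (m * π * x / 2) ^ 2 := by
  rw [fourierCosWeight, cos_sq]
  ring_nf

/-- **(2.10.4.1), cosine coefficient.** For `f` interval-integrable on `[-π, π]` and any real `m`,
`(1/2π) ∫_{-π}^{π} f(x) cos mx dx = ∫_{-1}^{1} f(πx) c_m(x) dx - ½ ∫_{-1}^{1} f(πx) dx`.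
[cite: DavisRabinowitz1984, Sect. 2.10.4 (2.10.4.1)] -/
theorem fourier_cos_coeff_eq_integral_fourierCosWeight (f : ℝ → ℝ) (m : ℝ)
    (hf : IntervalIntegrable f volume (-π) π) :
    1 / (2 * π) * ∫ x in (-π)..π, f x * cos (m * x)
      = (∫ x in (-1 : ℝ)..1, f (π * x) * fourierCosWeight m x) - 1 / 2 * ∫ x in (-1 : ℝ)..1, f (π * x) := by
  have h1 : IntervalIntegrable (fun x => f (π * x)) volume (-1) 1 := by
    have h := hf.comp_mul_left (c := π)
    rwa [neg_div, div_self pi_ne_zero] at h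
  have h2 : IntervalIntegrable (fun x => f (π * x) * cos (m * π * x)) volume (-1) 1 :=
    h1.mul_continuousOn (by fun_prop : Continuous fun x : ℝ => cos (m * π * x)).continuousOn
  have key : (∫ x in (-1 : ℝ)..1, f (π * x) * fourierCosWeight m x)
      = 1 / 2 * (∫ x in (-1 : ℝ)..1, f (π * x)) + 1 / 2 * ∫ x in (-1 : ℝ)..1, f (π * x) * cos (m * π * x) := by
    have hfun : (fun x => f (π * x) * fourierCosWeight m x)
        = fun x => 1 / 2 * f (π * x) + 1 / 2 * (f (π * x) * cos (m * π * x)) := by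
      funext x; simp only [fourierCosWeight]; ring
    rw [hfun, intervalIntegral.integral_add (h1.const_mul _) (h2.const_mul _),
      intervalIntegral.integral_const_mul, intervalIntegral.integral_const_mul]
  have sub : (∫ x in (-1 : ℝ)..1, f (π * x) * cos (m * π * x)) = π⁻¹ * ∫ x in (-π)..π, f x * cos (m * x) := by
    have h := intervalIntegral.integral_comp_mul_left (fun u => f u * cos (m * u)) pi_ne_zero (a := -1) (b := 1)
    simpa [mul_assoc] using h
  rw [key, sub]
  ring

/-- **(2.10.4.1), sine coefficient.** For `f` interval-integrable on `[-π, π]` and any real `m`,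
`(1/2π) ∫_{-π}^{π} f(x) sin mx dx = ∫_{-1}^{1} f(πx) s_m(x) dx - ½ ∫_{-1}^{1} f(πx) dx`.
[cite: DavisRabinowitz1984, Sect. 2.10.4 (2.10.4.1)] -/
theorem fourier_sin_coeff_eq_integral_fourierSinWeight (f : ℝ → ℝ) (m : ℝ)
    (hf : IntervalIntegrable f volume (-π) π) :
    1 / (2 * π) * ∫ x in (-π)..π, f x * sin (m * x)
      = (∫ x in (-1 : ℝ)..1, f (π * x) * fourierSinWeight m x) - 1 / 2 * ∫ x in (-1 : ℝ)..1, f (π * x) := by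
  have h1 : IntervalIntegrable (fun x => f (π * x)) volume (-1) 1 := by
    have h := hf.comp_mul_left (c := π)
    rwa [neg_div, div_self pi_ne_zero] at h
  have h2 : IntervalIntegrable (fun x => f (π * x) * sin (m * π * x)) volume (-1) 1 :=
    h1.mul_continuousOn (by fun_prop : Continuous fun x : ℝ => sin (m * π * x)).continuousOn
  have key : (∫ x in (-1 : ℝ)..1, f (π * x) * fourierSinWeight m x)
      = 1 / 2 * (∫ x in (-1 : ℝ)..1, f (π * x)) + 1 / 2 * ∫ x in (-1 : ℝ)..1, f (π * x) * sin (m * π * x) := by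
    have hfun : (fun x => f (π * x) * fourierSinWeight m x)
        = fun x => 1 / 2 * f (π * x) + 1 / 2 * (f (π * x) * sin (m * π * x)) := by
      funext x; simp only [fourierSinWeight]; ring
    rw [hfun, intervalIntegral.integral_add (h1.const_mul _) (h2.const_mul _),
      intervalIntegral.integral_const_mul, intervalIntegral.integral_const_mul]
  have sub : (∫ x in (-1 : ℝ)..1, f (π * x) * sin (m * π * x)) = π⁻¹ * ∫ x in (-π)..π, f x * sin (m * x) := by
    have h := intervalIntegral.integral_comp_mul_left (fun u => f u * sin (m * u)) pi_ne_zero (a := -1) (b := 1)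
    simpa [mul_assoc] using h
  rw [key, sub]
  ring

/-! ### Folding an odd / even weight onto the half interval: the shapes (2.10.4.3) and (2.10.4.5) -/

/-- `0 ∈ [[-a, a]]` for every real `a` (elementary helper). [folklore] -/
private theorem zero_mem_uIcc_neg_self (a : ℝ) : (0 : ℝ) ∈ uIcc (-a) a := by
  rcases le_total 0 a with h | h
  · exact mem_uIcc.mpr (Or.inl ⟨by linarith, h⟩)
  · exact mem_uIcc.mpr (Or.inr ⟨h, by linarith⟩)

/-- **Odd weight, antisymmetric rule shape (2.10.4.3).** For every `g` interval-integrable on `[-a, a]`,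
`∫_{-a}^{a} sin x g(x) dx = ∫₀^{a} sin x (g(x) - g(-x)) dx`: an integral against the odd weight `sin x`
only sees the odd part of `g`, which is why the Gauss-type rules for it have the form `Σ w_k [g(x_k) - g(-x_k)]`.
[cite: DavisRabinowitz1984, Sect. 2.10.4 (2.10.4.3)] -/
theorem integral_sin_mul_eq_integral_fold (g : ℝ → ℝ) {a : ℝ} (hg : IntervalIntegrable g volume (-a) a) :
    ∫ x in (-a)..a, sin x * g x = ∫ x in (0 : ℝ)..a, sin x * (g x - g (-x)) := by
  have hsg : IntervalIntegrable (fun x => sin x * g x) volume (-a) a :=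
    hg.continuousOn_mul continuous_sin.continuousOn
  have h0 := zero_mem_uIcc_neg_self a
  have hL : IntervalIntegrable (fun x => sin x * g x) volume (-a) 0 := hsg.mono_set (uIcc_subset_uIcc_left h0)
  have hR : IntervalIntegrable (fun x => sin x * g x) volume 0 a := hsg.mono_set (uIcc_subset_uIcc_right h0)
  -- `x ↦ g (-x)` is interval-integrable on `[-a, a]`, hence `x ↦ sin x * g (-x)` on `[0, a]`
  have hgn : IntervalIntegrable (fun x => g (-x)) volume (-a) a := by
    have h := (IntervalIntegrable.iff_comp_neg (f := g) (a := -a) (b := a)).mp hg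
    simpa using h.symm
  have hRn : IntervalIntegrable (fun x => sin x * g (-x)) volume 0 a :=
    (hgn.continuousOn_mul continuous_sin.continuousOn).mono_set (uIcc_subset_uIcc_right h0)
  have hneg : ∫ x in (-a)..0, sin x * g x = -∫ x in (0 : ℝ)..a, sin x * g (-x) := by
    have h := intervalIntegral.integral_comp_neg (f := fun x => sin x * g x) (a := 0) (b := a)
    simp only [sin_neg, neg_mul, neg_zero, intervalIntegral.integral_neg] at h
    linarith
  rw [← intervalIntegral.integral_add_adjacent_intervals hL hR, hneg,
    show (fun x => sin x * (g x - g (-x))) = fun x => sin x * g x - sin x * g (-x) from funext fun x => by ring,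
    intervalIntegral.integral_sub hR hRn]
  ring

/-- **Even weight, symmetric rule shape (2.10.4.5).** For every `g` interval-integrable on `[-a, a]`,
`∫_{-a}^{a} cos x g(x) dx = ∫₀^{a} cos x (g(x) + g(-x)) dx`: an integral against the even weight `cos x` only
sees the even part of `g`, which is why the rules tabulated by Piessens and Branders have the symmetric form
`Σ w_k [g(x_k) + g(-x_k)] + w_{N+1} g(0)`. [cite: DavisRabinowitz1984, Sect. 2.10.4 (2.10.4.5)] -/
theorem integral_cos_mul_eq_integral_fold (g : ℝ → ℝ) {a : ℝ} (hg : IntervalIntegrable g volume (-a) a) :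
    ∫ x in (-a)..a, cos x * g x = ∫ x in (0 : ℝ)..a, cos x * (g x + g (-x)) := by
  have hcg : IntervalIntegrable (fun x => cos x * g x) volume (-a) a :=
    hg.continuousOn_mul continuous_cos.continuousOn
  have h0 := zero_mem_uIcc_neg_self a
  have hL : IntervalIntegrable (fun x => cos x * g x) volume (-a) 0 := hcg.mono_set (uIcc_subset_uIcc_left h0)
  have hR : IntervalIntegrable (fun x => cos x * g x) volume 0 a := hcg.mono_set (uIcc_subset_uIcc_right h0)
  have hgn : IntervalIntegrable (fun x => g (-x)) volume (-a) a := by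
    have h := (IntervalIntegrable.iff_comp_neg (f := g) (a := -a) (b := a)).mp hg
    simpa using h.symm
  have hRn : IntervalIntegrable (fun x => cos x * g (-x)) volume 0 a :=
    (hgn.continuousOn_mul continuous_cos.continuousOn).mono_set (uIcc_subset_uIcc_right h0)
  have hneg : ∫ x in (-a)..0, cos x * g x = ∫ x in (0 : ℝ)..a, cos x * g (-x) := by
    have h := intervalIntegral.integral_comp_neg (f := fun x => cos x * g x) (a := 0) (b := a)
    simp only [cos_neg, neg_zero] at h
    exact h.symm
  rw [← intervalIntegral.integral_add_adjacent_intervals hL hR, hneg,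
    show (fun x => cos x * (g x + g (-x))) = fun x => cos x * g x + cos x * g (-x) from funext fun x => by ring,
    intervalIntegral.integral_add hR hRn]
  ring

/-! ### The panel decomposition behind (2.10.4.2) and (2.10.4.4) -/

/-- **Panel decomposition.** For `n ≥ 1` and `f` interval-integrable on `[0, 1]`, splitting `[0, 1]` into the
panels `[j/n, (j+1)/n]` and substituting `u = 2πnx - (2j+1)π` on the `j`-th one,
`∫₀¹ φ(2πnx) f(x) dx = (1/2πn) Σ_{j<n} ∫_{-π}^{π} φ(u + (2j+1)π) f(u/2πn + (2j+1)/2n) du`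
for every continuous `φ`. [cite: DavisRabinowitz1984, Sect. 2.10.4 (2.10.4.2), (2.10.4.4)] -/
theorem integral_comp_panels (φ f : ℝ → ℝ) (hφ : Continuous φ) {n : ℕ} (hn : n ≠ 0)
    (hf : IntervalIntegrable f volume 0 1) :
    ∫ x in (0 : ℝ)..1, φ (2 * π * n * x) * f x
      = 1 / (2 * π * n) * ∑ j ∈ Finset.range n, ∫ u in (-π)..π,
          φ (u + (2 * j + 1) * π) * f (u / (2 * π * n) + (2 * j + 1) / (2 * n)) := by
  have hn' : (n : ℝ) ≠ 0 := Nat.cast_ne_zero.mpr hn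
  have hc : (2 * π * n : ℝ) ≠ 0 := by positivity
  set F : ℝ → ℝ := fun x => φ (2 * π * n * x) * f x with hF
  have hFi : IntervalIntegrable F volume 0 1 :=
    hf.continuousOn_mul (by fun_prop : Continuous fun x : ℝ => φ (2 * π * n * x)).continuousOn
  -- each panel integral, pulled back to `[-π, π]`
  have panel : ∀ j : ℕ, (∫ u in (-π)..π, φ (u + (2 * j + 1) * π) * f (u / (2 * π * n) + (2 * j + 1) / (2 * n)))
      = 2 * π * n * ∫ x in (j / n : ℝ)..((j + 1) / n), F x := by
    intro j
    have harg : ∀ u : ℝ, 2 * π * n * (u / (2 * π * n) + (2 * j + 1) / (2 * n)) = u + (2 * j + 1) * π := by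
      intro u; field_simp
    have hfun : (fun u => φ (u + (2 * j + 1) * π) * f (u / (2 * π * n) + (2 * j + 1) / (2 * n)))
        = fun u => F (u / (2 * π * n) + (2 * j + 1) / (2 * n)) := by
      funext u; simp only [hF, harg]
    have h := intervalIntegral.integral_comp_div_add F hc ((2 * j + 1) / (2 * n)) (a := -π) (b := π)
    rw [hfun, h, smul_eq_mul]
    congr 1
    have ha : -π / (2 * π * n) + (2 * j + 1) / (2 * n) = (j / n : ℝ) := by field_simp; ring
    have hb : π / (2 * π * n) + (2 * j + 1) / (2 * n) = ((j + 1) / n : ℝ) := by field_simp; ring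
    rw [ha, hb]
  simp_rw [panel, ← Finset.mul_sum]
  have hsum := intervalIntegral.sum_integral_adjacent_intervals (f := F) (μ := volume)
    (a := fun k : ℕ => (k : ℝ) / n) (n := n) (fun k _ => ?_)
  · simp only [Nat.cast_zero, zero_div, div_self hn'] at hsum
    simp only [Nat.cast_add, Nat.cast_one] at hsum
    rw [hsum]
    field_simp
  · refine hFi.mono_set ?_
    have hk0 : (0 : ℝ) ≤ k / n := by positivity
    have hk1 : ((k : ℝ) + 1) / n ≤ 1 := by
      rw [div_le_one (by positivity)]
      have : (k : ℝ) + 1 ≤ n := by exact_mod_cast Nat.succ_le_of_lt ‹k < n›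
      exact this
    have hkk : (k : ℝ) / n ≤ (k + 1) / n := by gcongr; linarith
    push_cast
    rw [uIcc_of_le hkk, uIcc_of_le zero_le_one]
    exact Icc_subset_Icc hk0 hk1

/-- **Sine transform (2.10.4.2).** For `n ≥ 1` and `f` interval-integrable on `[0, 1]`,
`∫₀¹ sin 2πnx f(x) dx = -(1/2πn) Σ_{j<n} ∫_{-π}^{π} sin u · f(u/2πn + (2j+1)/2n) du` — a sum of `n` integrals
against the single odd weight `sin u` on `[-π, π]`, to which the rules (2.10.4.3) apply.
[cite: DavisRabinowitz1984, Sect. 2.10.4 (2.10.4.2)] -/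
theorem integral_sin_transform_panels (f : ℝ → ℝ) {n : ℕ} (hn : n ≠ 0)
    (hf : IntervalIntegrable f volume 0 1) :
    ∫ x in (0 : ℝ)..1, sin (2 * π * n * x) * f x
      = -(1 / (2 * π * n)) * ∑ j ∈ Finset.range n, ∫ u in (-π)..π,
          sin u * f (u / (2 * π * n) + (2 * j + 1) / (2 * n)) := by
  rw [integral_comp_panels sin f continuous_sin hn hf, neg_mul, ← mul_neg, ← Finset.sum_neg_distrib]
  congr 1
  refine Finset.sum_congr rfl fun j _ => ?_
  rw [← intervalIntegral.integral_neg]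
  refine intervalIntegral.integral_congr fun u _ => ?_
  have h : sin (u + (2 * j + 1) * π) = -sin u := by
    have := sin_add_nat_mul_pi u (2 * j + 1)
    rw [pow_succ, pow_mul] at this
    simp only [neg_one_sq, one_pow, one_mul, neg_mul, one_mul] at this
    exact_mod_cast this
  simp only [h, neg_mul]

/-- **Cosine transform (2.10.4.4).** For `n ≥ 1` and `f` interval-integrable on `[0, 1]`,
`∫₀¹ cos 2πnx f(x) dx = -(1/2πn) Σ_{j<n} ∫_{-π}^{π} cos u · f(u/2πn + (2j+1)/2n) du` — a sum of `n` integrals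
against the single even weight `cos u` on `[-π, π]` (rules (2.10.4.5)).
[cite: DavisRabinowitz1984, Sect. 2.10.4 (2.10.4.4)] -/
theorem integral_cos_transform_panels (f : ℝ → ℝ) {n : ℕ} (hn : n ≠ 0)
    (hf : IntervalIntegrable f volume 0 1) :
    ∫ x in (0 : ℝ)..1, cos (2 * π * n * x) * f x
      = -(1 / (2 * π * n)) * ∑ j ∈ Finset.range n, ∫ u in (-π)..π,
          cos u * f (u / (2 * π * n) + (2 * j + 1) / (2 * n)) := by
  rw [integral_comp_panels cos f continuous_cos hn hf, neg_mul, ← mul_neg, ← Finset.sum_neg_distrib]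
  congr 1
  refine Finset.sum_congr rfl fun j _ => ?_
  rw [← intervalIntegral.integral_neg]
  refine intervalIntegral.integral_congr fun u _ => ?_
  have h : cos (u + (2 * j + 1) * π) = -cos u := by
    have := cos_add_nat_mul_pi u (2 * j + 1)
    rw [pow_succ, pow_mul] at this
    simp only [neg_one_sq, one_pow, one_mul, neg_mul, one_mul] at this
    exact_mod_cast this
  simp only [h, neg_mul]

end Literature.Analysis.Quadrature

end
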